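import Summits.HodgeConjecture.HodgeConjecture.Theorems.NoetherLefschetzOneUpK3TypeNetsSurfaceProductsRankGap
import Summits.HodgeConjecture.HodgeConjecture.Theorems.NikulinTwinTransportSquareGlueFree

/-!
# `HC(S₁ × S₂)` from `Hom_Hdg(T(S₂)_ℚ, T(S₁)_ℚ) = 0`, and `HC(S × S)` from `End_Hdg(T(S)_ℚ) = ℚ`, in the language of `ℚ`-Hodge structures

Crux `K3TypeNets` (stmt-HodgeConjecture-11600), product sector, fifth file of gen 48. The gen-47 criteria
(`SurfaceProducts.hodgeConjectureFor_prod_of_hom_transcendental_eq_zero`,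
`SquareGlueFree.hodgeConjectureFor_square_of_hodgeEndomorphisms_scalar`) quantify over `ℂ`-linear maps of
`H²(–(ℂ); ℂ)` preserving rational classes and Hodge types. This file restates them ONCE AND FOR ALL on the
tree's `ℚ`-Hodge structures (`Motives.HodgeStructure`, `SubHodgeStructure`, `Hom`): for ANY smooth
projective complex surfaces (no hypothesis on `p_g`, `b₁`),

* `hom_transcendental_eq_zero_of_hom` / `hodgeConjectureFor_prod_of_hom` — **if every morphism of Hodge
  structures `T(S₂)_ℚ → T(S₁)_ℚ` (between the sub-Hodge structures of `H²_B` underlying the transcendental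
  lattices `Hdg¹^⊥`, `exists_transcendental_subHodgeStructure'`) is zero, then `HC(S₁ × S₂)`**;
* `hodgeEndomorphisms_scalar_of_hom` / `hodgeConjectureFor_square_of_hom` — **if every endomorphism of the
  Hodge structure `T(S)_ℚ` is a rational scalar, then `HC(S × S)`**.

The previous files of this gen are the cases where these hypotheses are AUTOMATIC (odd prime rank:
`End = ℚ`; rank gap / unequal ranks with irreducible target: `Hom = 0`); this form is the port through
which any further `End_Hdg` / `Hom_Hdg` computation on the abstract side (e.g. rank `4` without CM,
Kuga–Satake arguments) reaches the summit statement.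

No definition, no named-fact hypothesis, no sorry. Prover seat ring2-b02 (gen 48).

References: D. Huybrechts, *Lectures on K3 Surfaces*, Ch. 3 Lemma 3.1 and §3.3; D. Huybrechts, *Motives of
isogenous K3 surfaces* (2019), §1, Cor. 0.4; M. Varesco (2023), §2 p. 8; C. Voisin, *Hodge Theory I*, §11.3.3.
-/

set_option linter.dupNamespace false

noncomputable section

namespace Summit.HodgeConjecture.HodgeConjecture.Theorems.OddPrimeSquares

open scoped TensorProduct
open CategoryTheory MonoidalCategory Literature.AlgebraicGeometry Literature.AlgebraicGeometry.Motives
open Literature.AlgebraicGeometry.HodgeTheory Literature.AlgebraicTopology.SingularHomology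
open Literature.AlgebraicGeometry.Motives.HodgeStructure

variable {S₁ S₂ : SchemeOver ℂ}

/-- `H²_B(S)`: the weight-two `ℚ`-Hodge structure on `H²(S(ℂ); ℚ)` of the real Hodge model of `S`. -/
local notation3 "H²[" hS "]" =>
  bettiTwoHodgeStructure hS (BettiUniverse.realHodgeModel exists_isReal_hodgeModel_holds hS)
    (BettiUniverse.realHodgeModel_isHodgeSymmetric exists_isReal_hodgeModel_holds hS)

/-- `T(S)_ℚ = Hdg¹^⊥ ⊆ H²(S(ℂ); ℚ)`. -/
local notation3 "T[" hS "]" =>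
  transcendentalLatticeBetti hS (BettiUniverse.realHodgeModel exists_isReal_hodgeModel_holds hS)
    (BettiUniverse.realHodgeModel_isHodgeSymmetric exists_isReal_hodgeModel_holds hS)

/-- `Θ : ℂ ⊗_ℚ H²(S(ℂ); ℚ) → H²(S(ℂ); ℂ)`. -/
local notation3 "Θ[" S "]" => ofRatClassBaseChange (Motives.ComplexPoints S) (2 * 1)

/-! ### Two factors: `Hom_Hdg(T(S₂)_ℚ, T(S₁)_ℚ) = 0 ⟹ HC(S₁ × S₂)` -/

/-- **`Hom_Hdg(T(S₂)_ℚ, T(S₁)_ℚ) = 0` on the `ℚ`-Hodge structures implies the `hT₀` clause of the gen-47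
criterion.** For any two smooth projective complex surfaces and sub-Hodge structures `T₁`, `T₂` of
`H²_B(S₁)`, `H²_B(S₂)` underlying the transcendental lattices: if every morphism of Hodge structures
`T₂ → T₁` is zero, then every `ℂ`-linear `f : H²(S₂(ℂ); ℂ) → H²(S₁(ℂ); ℂ)` preserving rational classes and
Hodge types with image cup-orthogonal to `N¹H²(S₁)` vanishes on `(N¹H²(S₂))^⊥`.
[cite: Huybrechts2019, §1] [cite: VoisinHodgeI2002, §7.3.1 and §11.3.3] -/
theorem hom_transcendental_eq_zero_of_hom (h₁ : IsSmoothProjective 2 S₁) (h₂ : IsSmoothProjective 2 S₂)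
    (T₁ : SubHodgeStructure (H²[h₁])) (hT₁ : T₁.toSubmodule = T[h₁])
    (T₂ : SubHodgeStructure (H²[h₂])) (hT₂ : T₂.toSubmodule = T[h₂])
    (hHom : ∀ φ : Hom T₂.toHodgeStructure T₁.toHodgeStructure, φ.toLinearMap = 0)
    (f : complexBetti S₂ (2 * 1) →ₗ[ℂ] complexBetti S₁ (2 * 1))
    (hf₁ : ∀ y, IsRationalClass y → IsRationalClass (f y))
    (hf₂ : ∀ (i j : ℕ) y, IsOfHodgeType 2 S₂ (2 * 1) i j y → IsOfHodgeType 2 S₁ (2 * 1) i j (f y))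
    (hf₄ : ∀ y : complexBetti S₂ (2 * 1), ∀ d ∈ algebraicClasses S₁ 1,
      cupProduct (rfl : 2 * 1 + 2 * 1 = 2 * 2) (f y) d = 0)
    (y : complexBetti S₂ (2 * 1))
    (hy : ∀ d ∈ algebraicClasses S₂ 1, cupProduct (rfl : 2 * 1 + 2 * 1 = 2 * 2) y d = 0) : f y = 0 := by
  haveI : Module.Finite ℚ (bettiCohomology S₁ (2 * 1)) := BettiUniverse.finite h₁ (2 * 1)
  haveI : Module.Finite ℚ (bettiCohomology S₂ (2 * 1)) := BettiUniverse.finite h₂ (2 * 1)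
  set M₁ := BettiUniverse.realHodgeModel exists_isReal_hodgeModel_holds h₁ with hM₁def
  set M₂ := BettiUniverse.realHodgeModel exists_isReal_hodgeModel_holds h₂ with hM₂def
  have hI := hodgePQ_independent_of_hodgeModel_holds
  have h4 : 2 * 1 + 2 * 1 = 2 * 2 := rfl
  -- descend `f`; `g` is a morphism `H²_B(S₂) → H²_B(S₁)` into `T(S₁)_ℚ`
  obtain ⟨g, hgofRat, hg⟩ := exists_ratHom_of_isRationalClass f hf₁
  have hgF : ∀ p : ℤ, ((H²[h₂]).F p).map (g.baseChange ℂ) ≤ (H²[h₁]).F p := by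
    intro p
    rintro _ ⟨x, hx, rfl⟩
    change x ∈ (BettiUniverse.hodge exists_isReal_hodgeModel_holds h₂ (2 * 1)).F p at hx
    change g.baseChange ℂ x ∈ (BettiUniverse.hodge exists_isReal_hodgeModel_holds h₁ (2 * 1)).F p
    rw [BettiUniverse.hodge_F, HodgeModel.ratF_eq_iSup] at hx ⊢
    induction hx using Submodule.iSup_induction' with
    | mem pq x hx =>
      by_cases hp' : p ≤ (pq.1.1 : ℤ)
      · rw [iSup_pos hp'] at hx
        refine Submodule.mem_iSup_of_mem pq (Submodule.mem_iSup_of_mem hp' ?_)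
        rw [HodgeModel.mem_ratPiece_iff, HodgeModel.complexification_apply] at hx ⊢
        have hx1 : IsOfHodgeType 2 S₂ (2 * 1) pq.1.1 pq.1.2 (Θ[S₂] x) := ⟨M₂, hx⟩
        have hx2 := hf₂ _ _ _ hx1
        rw [hg] at hx2
        obtain ⟨B, hB⟩ := hx2
        exact hI 2 S₁ h₁ B M₁ (2 * 1) _ _ _ hB
      · rw [iSup_neg hp', Submodule.mem_bot] at hx
        rw [hx, map_zero]
        exact Submodule.zero_mem _
    | zero => rw [map_zero]; exact Submodule.zero_mem _
    | add x y _ _ hx hy => rw [map_add]; exact Submodule.add_mem _ hx hy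
  let gH : Hom (H²[h₂]) (H²[h₁]) := ⟨g, hgF⟩
  have hN₁ : ∀ h ∈ (H²[h₁]).hodgeClasses 1,
      ofRatClass (Motives.ComplexPoints S₁) (2 * 1) h ∈ algebraicClasses S₁ 1 := fun h hh ↦ by
    rw [← map_hodgeClasses_baseChange_eq_algebraicClasses h₁]
    exact ⟨(1 : ℂ) ⊗ₜ h, Submodule.tmul_mem_baseChange_of_mem 1 hh,
      by rw [ofRatClassBaseChange_tmul, one_smul]⟩
  have hgT : ∀ v, g v ∈ T₁.toSubmodule := fun v ↦ by
    rw [hT₁, mem_transcendentalLatticeBetti_iff]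
    intro h hh
    rw [cupPairingBetti_apply]
    have hc : cupProduct (X := Motives.ComplexPoints S₁) (R := ℚ) h4 h (g v) = 0 := by
      apply ofRatClass_injective (Y := Motives.ComplexPoints S₁) (2 * 2)
      rw [map_zero, ofRatClass_eq_ringChange, singularCohomology.ringChange_cupProduct,
        ← ofRatClass_eq_ringChange, ← ofRatClass_eq_ringChange, hgofRat,
        cupProduct_gradedComm_holds ℂ (Motives.ComplexPoints S₁) h4 h4, hf₄ _ _ (hN₁ h hh), smul_zero]
    rw [hc, map_zero]
  -- the restriction `T₂ → T₁` is a morphism of Hodge structures, hence zero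
  let g' : Hom T₂.toHodgeStructure T₁.toHodgeStructure := (gH.comp T₂.subtypeHom).codRestrict T₁ fun t ↦ hgT _
  have hzero := hHom g'
  have hgq : ∀ t : T₂.toSubmodule, g (t : bettiCohomology S₂ (2 * 1)) = 0 := by
    intro t
    have e1 := LinearMap.congr_fun hzero t
    have e2 : ((g'.toLinearMap t : T₁.toSubmodule) : bettiCohomology S₁ (2 * 1)) = g t := rfl
    rw [← e2, e1, LinearMap.zero_apply, Submodule.coe_zero]
  -- `y ⊥ N¹H²(S₂)` gives `Θ₂⁻¹ y ∈ T(S₂)_ℂ`, killed by `g ⊗ ℂ`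
  obtain ⟨x, rfl⟩ := ofRatClassBaseChange_surjective h₂ (2 * 1) y
  have hxT : x ∈ T₂.toSubmodule.baseChange ℂ := by
    rw [hT₂, transcendentalLatticeBetti, baseChange_orthogonal_eq _ (cupPairingBetti_nondegenerate h₂),
      LinearMap.BilinForm.mem_orthogonal_iff]
    intro z hz
    apply cupPairingBetti_baseChange_eq_zero_of_cup h₂
    rw [cup_baseChange_eq_zero_iff]
    have hzN : Θ[S₂] z ∈ algebraicClasses S₂ 1 := by
      rw [← map_hodgeClasses_baseChange_eq_algebraicClasses h₂]
      exact ⟨z, hz, rfl⟩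
    rw [cupProduct_gradedComm_holds ℂ (Motives.ComplexPoints S₂) h4 h4, hy _ hzN, smul_zero]
  obtain ⟨u, rfl⟩ := hxT
  have hgx : g.baseChange ℂ (T₂.toSubmodule.subtype.baseChange ℂ u) = 0 := by
    clear hy
    induction u using TensorProduct.induction_on with
    | zero => rw [map_zero, map_zero]
    | tmul c t =>
      rw [LinearMap.baseChange_tmul, LinearMap.baseChange_tmul, Submodule.subtype_apply, hgq t,
        TensorProduct.tmul_zero]
    | add u₁ u₂ e₁ e₂ => rw [map_add, map_add, e₁, e₂, add_zero]
  rw [hg, hgx, map_zero]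

/-- **`Hom_Hdg(T(S₂)_ℚ, T(S₁)_ℚ) = 0 ⟹ HC(S₁ × S₂)`** for any two smooth projective complex surfaces, the
transcendental lattices being carried by the sub-Hodge structures of `exists_transcendental_subHodgeStructure'`
(the hypothesis is asked for every such pair `T₁, T₂`, which are unique as subspaces).
[cite: Huybrechts2019, §1 and Cor. 0.4] [cite: VoisinHodgeI2002, §11.3.3 Lemma 11.41] -/
theorem hodgeConjectureFor_prod_of_hom (h₁ : IsSmoothProjective 2 S₁) (h₂ : IsSmoothProjective 2 S₂)
    (hHom : ∀ (T₁ : SubHodgeStructure (H²[h₁])), T₁.toSubmodule = T[h₁] →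
      ∀ (T₂ : SubHodgeStructure (H²[h₂])), T₂.toSubmodule = T[h₂] →
        ∀ φ : Hom T₂.toHodgeStructure T₁.toHodgeStructure, φ.toLinearMap = 0) :
    HodgeConjectureFor 4 (S₁ ⊗ S₂) := by
  obtain ⟨T₁, hT₁⟩ := exists_transcendental_subHodgeStructure' h₁
  obtain ⟨T₂, hT₂⟩ := exists_transcendental_subHodgeStructure' h₂
  exact SurfaceProducts.hodgeConjectureFor_prod_of_hom_transcendental_eq_zero h₁ h₂
    fun f hf₁ hf₂ _ hf₄ y hy ↦
      hom_transcendental_eq_zero_of_hom h₁ h₂ T₁ hT₁ T₂ hT₂ (hHom T₁ hT₁ T₂ hT₂) f hf₁ hf₂ hf₄ y hy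

/-! ### One factor twice: `End_Hdg(T(S)_ℚ) = ℚ ⟹ HC(S × S)` -/

/-- **`End_Hdg(T(S)_ℚ) = ℚ` on the `ℚ`-Hodge structure implies the `hU₀` clause of the gen-47 criterion**:
if every endomorphism of the Hodge structure `T(S)_ℚ` (a sub-Hodge structure `T` of `H²_B(S)` on `Hdg¹^⊥`)
is a rational scalar, then every rational, type-preserving `f` on `H²(S(ℂ); ℂ)` with image `⊥ N¹H²` acts on
`(N¹H²)^⊥` as a rational scalar. [cite: Varesco2023, §2 (p. 8)] [cite: Huybrechts2016K3, Ch. 3 §3.3] -/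
theorem hodgeEndomorphisms_scalar_of_hom {S : SchemeOver ℂ} (hS : IsSmoothProjective 2 S)
    (T : SubHodgeStructure (H²[hS])) (hT : T.toSubmodule = T[hS])
    (hscal : ∀ φ : Hom T.toHodgeStructure T.toHodgeStructure, ∃ q : ℚ,
      φ.toLinearMap = q • (LinearMap.id : Module.End ℚ T.toSubmodule))
    (f : complexBetti S (2 * 1) →ₗ[ℂ] complexBetti S (2 * 1))
    (hf₁ : ∀ y, IsRationalClass y → IsRationalClass (f y))
    (hf₂ : ∀ (i j : ℕ) y, IsOfHodgeType 2 S (2 * 1) i j y → IsOfHodgeType 2 S (2 * 1) i j (f y))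
    (hf₄ : ∀ y : complexBetti S (2 * 1), ∀ d ∈ algebraicClasses S 1,
      cupProduct (rfl : 2 * 1 + 2 * 1 = 2 * 2) (f y) d = 0) :
    ∃ a : ℚ, ∀ y : complexBetti S (2 * 1),
      (∀ d ∈ algebraicClasses S 1, cupProduct (rfl : 2 * 1 + 2 * 1 = 2 * 2) y d = 0) →
      f y = (a : ℂ) • y := by
  haveI : Module.Finite ℚ (bettiCohomology S (2 * 1)) := BettiUniverse.finite hS (2 * 1)
  set M := BettiUniverse.realHodgeModel exists_isReal_hodgeModel_holds hS with hMdef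
  have hI := hodgePQ_independent_of_hodgeModel_holds
  have h4 : 2 * 1 + 2 * 1 = 2 * 2 := rfl
  obtain ⟨g, hgofRat, hg⟩ := exists_ratHom_of_isRationalClass f hf₁
  have hgF : ∀ p : ℤ, ((H²[hS]).F p).map (g.baseChange ℂ) ≤ (H²[hS]).F p := by
    intro p
    rintro _ ⟨x, hx, rfl⟩
    change x ∈ (BettiUniverse.hodge exists_isReal_hodgeModel_holds hS (2 * 1)).F p at hx
    change g.baseChange ℂ x ∈ (BettiUniverse.hodge exists_isReal_hodgeModel_holds hS (2 * 1)).F p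
    rw [BettiUniverse.hodge_F, HodgeModel.ratF_eq_iSup] at hx ⊢
    induction hx using Submodule.iSup_induction' with
    | mem pq x hx =>
      by_cases hp' : p ≤ (pq.1.1 : ℤ)
      · rw [iSup_pos hp'] at hx
        refine Submodule.mem_iSup_of_mem pq (Submodule.mem_iSup_of_mem hp' ?_)
        rw [HodgeModel.mem_ratPiece_iff, HodgeModel.complexification_apply] at hx ⊢
        have hx1 : IsOfHodgeType 2 S (2 * 1) pq.1.1 pq.1.2 (Θ[S] x) := ⟨M, hx⟩
        have hx2 := hf₂ _ _ _ hx1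
        rw [hg] at hx2
        obtain ⟨B, hB⟩ := hx2
        exact hI 2 S hS B M (2 * 1) _ _ _ hB
      · rw [iSup_neg hp', Submodule.mem_bot] at hx
        rw [hx, map_zero]
        exact Submodule.zero_mem _
    | zero => rw [map_zero]; exact Submodule.zero_mem _
    | add x y _ _ hx hy => rw [map_add]; exact Submodule.add_mem _ hx hy
  let gH : Hom (H²[hS]) (H²[hS]) := ⟨g, hgF⟩
  have hN : ∀ h ∈ (H²[hS]).hodgeClasses 1,
      ofRatClass (Motives.ComplexPoints S) (2 * 1) h ∈ algebraicClasses S 1 := fun h hh ↦ by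
    rw [← map_hodgeClasses_baseChange_eq_algebraicClasses hS]
    exact ⟨(1 : ℂ) ⊗ₜ h, Submodule.tmul_mem_baseChange_of_mem 1 hh,
      by rw [ofRatClassBaseChange_tmul, one_smul]⟩
  have hgT : ∀ v, g v ∈ T.toSubmodule := fun v ↦ by
    rw [hT, mem_transcendentalLatticeBetti_iff]
    intro h hh
    rw [cupPairingBetti_apply]
    have hc : cupProduct (X := Motives.ComplexPoints S) (R := ℚ) h4 h (g v) = 0 := by
      apply ofRatClass_injective (Y := Motives.ComplexPoints S) (2 * 2)
      rw [map_zero, ofRatClass_eq_ringChange, singularCohomology.ringChange_cupProduct,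
        ← ofRatClass_eq_ringChange, ← ofRatClass_eq_ringChange, hgofRat,
        cupProduct_gradedComm_holds ℂ (Motives.ComplexPoints S) h4 h4, hf₄ _ _ (hN h hh), smul_zero]
    rw [hc, map_zero]
  let g' : Hom T.toHodgeStructure T.toHodgeStructure := (gH.comp T.subtypeHom).codRestrict T fun t ↦ hgT _
  obtain ⟨q, hq⟩ := hscal g'
  have hgq : ∀ t : T.toSubmodule, g (t : bettiCohomology S (2 * 1)) = q • (t : bettiCohomology S (2 * 1)) := by
    intro t
    have e1 := LinearMap.congr_fun hq t
    have e2 : ((g'.toLinearMap t : T.toSubmodule) : bettiCohomology S (2 * 1)) = g t := rfl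
    rw [← e2, e1, LinearMap.smul_apply, LinearMap.id_apply, Submodule.coe_smul]
  refine ⟨q, fun y hy ↦ ?_⟩
  obtain ⟨x, rfl⟩ := ofRatClassBaseChange_surjective hS (2 * 1) y
  have hxT : x ∈ T.toSubmodule.baseChange ℂ := by
    rw [hT, transcendentalLatticeBetti, baseChange_orthogonal_eq _ (cupPairingBetti_nondegenerate hS),
      LinearMap.BilinForm.mem_orthogonal_iff]
    intro z hz
    apply cupPairingBetti_baseChange_eq_zero_of_cup hS
    rw [cup_baseChange_eq_zero_iff]
    have hzN : Θ[S] z ∈ algebraicClasses S 1 := by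
      rw [← map_hodgeClasses_baseChange_eq_algebraicClasses hS]
      exact ⟨z, hz, rfl⟩
    rw [cupProduct_gradedComm_holds ℂ (Motives.ComplexPoints S) h4 h4, hy _ hzN, smul_zero]
  obtain ⟨u, rfl⟩ := hxT
  have hgx : g.baseChange ℂ (T.toSubmodule.subtype.baseChange ℂ u) =
      (q : ℂ) • T.toSubmodule.subtype.baseChange ℂ u := by
    clear hy
    induction u using TensorProduct.induction_on with
    | zero => rw [map_zero, map_zero, smul_zero]
    | tmul c t =>
      rw [LinearMap.baseChange_tmul, LinearMap.baseChange_tmul, Submodule.subtype_apply, hgq t,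
        TensorProduct.tmul_smul, Rat.cast_smul_eq_qsmul]
    | add u₁ u₂ e₁ e₂ => rw [map_add, map_add, e₁, e₂, smul_add]
  rw [hg, hgx, map_smul]

/-- **`End_Hdg(T(S)_ℚ) = ℚ ⟹ HC(S × S)`** for any smooth projective complex surface `S`: if every
endomorphism of the `ℚ`-Hodge structure on the transcendental lattice (for the sub-Hodge structure of
`H²_B(S)` on `Hdg¹^⊥`, `exists_transcendental_subHodgeStructure'`) is a rational scalar, the Hodge
conjecture holds for `S ⊗ S` in every codimension (`SquareGlueFree.hodgeConjectureFor_square_of_hodgeEndomorphisms_scalar`).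
[cite: Varesco2023, §2 (p. 8)] [cite: Huybrechts2019, §1 and Cor. 0.4] -/
theorem hodgeConjectureFor_square_of_hom {S : SchemeOver ℂ} (hS : IsSmoothProjective 2 S)
    (hscal : ∀ (T : SubHodgeStructure (H²[hS])), T.toSubmodule = T[hS] →
      ∀ φ : Hom T.toHodgeStructure T.toHodgeStructure, ∃ q : ℚ,
        φ.toLinearMap = q • (LinearMap.id : Module.End ℚ T.toSubmodule)) :
    HodgeConjectureFor 4 (S ⊗ S) := by
  obtain ⟨T, hT⟩ := exists_transcendental_subHodgeStructure' hS
  exact NikulinTwinTransport.SquareGlueFree.hodgeConjectureFor_square_of_hodgeEndomorphisms_scalar hS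
    fun f hf₁ hf₂ _ hf₄ ↦ hodgeEndomorphisms_scalar_of_hom hS T hT (hscal T hT) f hf₁ hf₂ hf₄

end Summit.HodgeConjecture.HodgeConjecture.Theorems.OddPrimeSquares

end
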